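import Summits.HubbardSuperconductivity.HubbardSuperconductivity.Theorems.JosephsonMirrorJmCuspSummitSandwich
import Summits.HubbardSuperconductivity.HubbardSuperconductivity.Theorems.JosephsonMirrorJmCuspFreeLayersNotSimple
import Summits.HubbardSuperconductivity.HubbardSuperconductivity.Theorems.JosephsonMirrorJmCuspHalfFilledSimple
import Literature.MathematicalPhysics.QuantumLattice.XYOrderGDProofs
import HarnessLib

/-!
# Crux `JmCusp` (stmt-HubbardSuperconductivity-2228) — STRATEGY CENSUS, typed companion

Crux-strategist seat `planner-cstrat-stmt-HubbardSuperconductivity-2228-s1-0` (2026-08-17).  This file is NOT a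
skeleton line (no `stub_*`, no `JmCusp_of`, no `sorry`): it types the four census headings of
`Cruxes/JmCusp/STRATEGY-CENSUS.md` over the tree's declarations, so that every signature quoted there
elaborates and every implication claimed there is kernel-checked.

* `ZepoAt`, `SimpleAt` — the two conjuncts of the landed normal form (p134917,
  `jmCusp_iff_zeroExcessPairOrder_and_simple`): `JmCusp ↔ ∃ U > 0, δ ∈ (0,1/2), ZepoAt U δ ∧ SimpleAt U δ`
  (`jmCusp_iff_exists_zepoAt_and_simpleAt`).
* DECOMPOSITION.  (D-a) `CoreAtSomePoint` + `OrderForcesSimplicity` ⇒ `JmCusp` (`jmCusp_of_core_split`);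
  piece 1 is BELOW the summit (`coreAtSomePoint_of_summit`: the summit statement itself implies it) and
  BELOW the crux (`coreAtSomePoint_of_jmCusp`), i.e. it is the summit's open core at a point; piece 2 is a
  phase-diagram-wide universal.  (D-b) the regime split `CoreInWindow` + `SimpleInWindow` ⇒ `JmCusp`
  (`jmCusp_of_window_split`), whose simplicity half is FALSE at the closed end `U = 0` of every window
  (`not_simpleAt_zero`, p142929).
* STRENGTHEN.  `SummitAtSimplePoint ⇒ JmCusp` (p140841); `GappedRigidPoint ⇒ JmCusp` where the proof
  DISCARDS the gap (`jmCusp_of_gappedRigidPoint`); `UniformZepoAt` (every low-energy state ordered) still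
  needs `SimpleAt` verbatim to reach the crux (`jmCusp_of_uniformZepo_and_simple`).
* NEGATION.  `not_jmCusp_iff`: `¬JmCusp ↔ ∀ U > 0, ∀ δ ∈ (0,1/2), ZepoAt U δ → ¬SimpleAt U δ` — a
  counterexample is a theorem about EVERY point of the quadrant; the accessible edges are calibrated
  (`not_simpleAt_zero`, `simpleAt_of_neg`, attractive side) but lie outside the quadrant.
* TRANSFER.  The solved sibling of clause (i) in the tree is Kennedy–Lieb–Shastry
  (`transfer_anchor_KLS` = `kennedy_lieb_shastry_xy_ground_holds`); of clause (ii), Lieb 1989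
  (`simpleAt_of_neg`, `jmCusp_clauseII_holds_at_half_filling`).  Where each breaks is prose in the census.

Pure logic over landed theorems; standard axioms; nothing here claims either conjunct at any point of
`{U > 0} × (0, 1/2)`.
-/

noncomputable section

set_option linter.dupNamespace false

namespace Summit.HubbardSuperconductivity.HubbardSuperconductivity.Cruxes.JmCusp.StrategyCensus

open Matrix Literature.MathematicalPhysics.QuantumLattice Literature.Barriers.HubbardSuperconductivity
open Summit.HubbardSuperconductivity.HubbardSuperconductivity.Theses.JosephsonMirror (JmCusp)
open Summit.HubbardSuperconductivity.HubbardSuperconductivity.Theorems.JosephsonMirror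

/-! ### The two conjuncts of the normal form, pointwise -/

/-- Zero-excess `d`-wave pair order at `(U, δ)` (verbatim the right-hand side of
`josephsonGain_iff_zeroExcessPairOrder`, p134917): some `c > 0` such that for every `ε > 0`, eventually in
even `L`, a unit vector of sector `N_L` or `N_L − 2` (`S^z = 0`) lies within `εL²` of its sector floor and
has `‖Δ_d v‖² ≥ cL⁴`. [folklore] -/
def ZepoAt (U δ : ℝ) : Prop :=
  ∃ c : ℝ, 0 < c ∧ ∀ ε : ℝ, 0 < ε → ∃ L₀ : ℕ, ∀ (L : ℕ) [NeZero L], Even L → L₀ ≤ L →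
    ∃ n : ℕ, (n = 2 * ⌊(1 - δ) * (L : ℝ) ^ 2 / 2⌋₊ ∨ n = 2 * ⌊(1 - δ) * (L : ℝ) ^ 2 / 2⌋₊ - 2) ∧
      ∃ v : Fock (Orb (FermionTorus 2 L)), v ∈ szSector n 0 ∧ star v ⬝ᵥ v = 1 ∧
        (star v ⬝ᵥ (hubbardTorus 2 L 1 U *ᵥ v)).re ≤
            (hubbardTorus 2 L 1 U).minEnergyOn (szSector n 0) + ε * (L : ℝ) ^ 2 ∧
        c * (L : ℝ) ^ 4 ≤
          (star (pairField dWaveFormFactor L *ᵥ v) ⬝ᵥ (pairField dWaveFormFactor L *ᵥ v)).re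

/-- Eventual simplicity of the `(N_L, S^z = 0)` ground state at `(U, δ)` (clause (ii) of `JmCusp`,
verbatim). [folklore] -/
def SimpleAt (U δ : ℝ) : Prop :=
  ∃ L₀ : ℕ, ∀ (L : ℕ), Even L → L₀ ≤ L → ∀ φ φ' : Fock (Orb (FermionTorus 2 L)),
    IsGroundStateInSector (hubbardTorus 2 L 1 U) (2 * ⌊(1 - δ) * (L : ℝ) ^ 2 / 2⌋₊) 0 φ →
    IsGroundStateInSector (hubbardTorus 2 L 1 U) (2 * ⌊(1 - δ) * (L : ℝ) ^ 2 / 2⌋₊) 0 φ' →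
    ∃ c : ℂ, φ' = c • φ

/-- The crux in pointwise normal form (p134917, renamed). [folklore] -/
theorem jmCusp_iff_exists_zepoAt_and_simpleAt :
    JmCusp ↔ ∃ U : ℝ, 0 < U ∧ ∃ δ ∈ Set.Ioo (0:ℝ) (1 / 2), ZepoAt U δ ∧ SimpleAt U δ :=
  jmCusp_iff_zeroExcessPairOrder_and_simple

/-- The summit's matrix at a point gives the first conjunct at that point (p140841 ∘ p134917): `ZepoAt` is
a CONSEQUENCE of the summit, point by point. [folklore] -/
theorem zepoAt_of_hasDWavePairFieldLROAt (U δ : ℝ) (hU : 0 < U) (hδ : δ ∈ Set.Ioo (0:ℝ) (1 / 2))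
    (h : HasDWavePairFieldLROAt U δ) : ZepoAt U δ :=
  (josephsonGain_iff_zeroExcessPairOrder U δ hU hδ).1 (josephsonGain_of_hasDWavePairFieldLROAt U δ hU hδ h)

/-! ### DECOMPOSITION (D-a): core at a point + "order forces simplicity" -/

/-- Piece 1 of split (D-a): zero-excess `d`-wave pair order at SOME point of the quadrant — the summit's open
core in its weakest (zero-excess, one-vector) form. [folklore] -/
def CoreAtSomePoint : Prop :=
  ∃ U : ℝ, 0 < U ∧ ∃ δ ∈ Set.Ioo (0:ℝ) (1 / 2), ZepoAt U δ

/-- Piece 2 of split (D-a): wherever zero-excess pair order holds, the `(N_L, 0)` floor is eventually simple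
— a universal statement over the whole quadrant `{U > 0} × (0, 1/2)`. [folklore] -/
def OrderForcesSimplicity : Prop :=
  ∀ U : ℝ, 0 < U → ∀ δ ∈ Set.Ioo (0:ℝ) (1 / 2), ZepoAt U δ → SimpleAt U δ

/-- The glue of split (D-a), kernel-checked: piece 2 → piece 1 → crux. [folklore] -/
theorem jmCusp_of_core_split (h₂ : OrderForcesSimplicity) (h₁ : CoreAtSomePoint) : JmCusp := by
  obtain ⟨U, hU, δ, hδ, hZ⟩ := h₁
  exact jmCusp_iff_exists_zepoAt_and_simpleAt.2 ⟨U, hU, δ, hδ, hZ, h₂ U hU δ hδ hZ⟩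

/-- Piece 1 is implied by the crux (it is the crux with clause (ii) deleted). [folklore] -/
theorem coreAtSomePoint_of_jmCusp (h : JmCusp) : CoreAtSomePoint := by
  obtain ⟨U, hU, δ, hδ, hZ, _⟩ := jmCusp_iff_exists_zepoAt_and_simpleAt.1 h
  exact ⟨U, hU, δ, hδ, hZ⟩

/-- Piece 1 is implied by the SUMMIT STATEMENT itself: `HubbardSuperconductivity → CoreAtSomePoint`.  So the
hard half of every split of `JmCusp` along its two conjuncts is a consequence of the summit at the witness
point and — modulo the sibling crux `JmInterchange` and clause (ii) — gives it back
(`summitMatrix_of_jmInterchange_of_jmCusp`, p140841): it is the summit's own open problem, not a smaller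
statement. [folklore] -/
theorem coreAtSomePoint_of_summit (h : _root_.HubbardSuperconductivity) : CoreAtSomePoint := by
  obtain ⟨U, hU, δ, hδ, hmat⟩ := h
  exact ⟨U, hU, δ, hδ, zepoAt_of_hasDWavePairFieldLROAt U δ hU hδ hmat⟩

/-! ### DECOMPOSITION (D-b): the regime split -/

/-- Piece 1 of split (D-b): the core somewhere in an explicit window `U ∈ (0, U₀]`, `δ ∈ [δ₁, δ₂]`.
[folklore] -/
def CoreInWindow (U₀ δ₁ δ₂ : ℝ) : Prop :=
  ∃ U ∈ Set.Ioc (0:ℝ) U₀, ∃ δ ∈ Set.Icc δ₁ δ₂, ZepoAt U δ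

/-- Piece 2 of split (D-b): eventual simplicity EVERYWHERE in the window. [folklore] -/
def SimpleInWindow (U₀ δ₁ δ₂ : ℝ) : Prop :=
  ∀ U ∈ Set.Ioc (0:ℝ) U₀, ∀ δ ∈ Set.Icc δ₁ δ₂, SimpleAt U δ

/-- The glue of split (D-b), kernel-checked. [folklore] -/
theorem jmCusp_of_window_split {U₀ δ₁ δ₂ : ℝ} (h₁ : 0 < δ₁) (h₂ : δ₂ < 1 / 2)
    (hS : SimpleInWindow U₀ δ₁ δ₂) (hC : CoreInWindow U₀ δ₁ δ₂) : JmCusp := by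
  obtain ⟨U, hU, δ, hδ, hZ⟩ := hC
  have hδ' : δ ∈ Set.Ioo (0:ℝ) (1 / 2) := ⟨lt_of_lt_of_le h₁ hδ.1, lt_of_le_of_lt hδ.2 h₂⟩
  exact jmCusp_iff_exists_zepoAt_and_simpleAt.2 ⟨U, hU.1, δ, hδ', hZ, hS U hU δ hδ⟩

/-- Calibration of piece 2 at the closed end of every window: at `U = 0` eventual simplicity FAILS for every
`δ ∈ (0, 1/2)` (open free shells infinitely often; p142929 `jmCusp_clauseII_fails_at_zero_coupling`).  So no
window version of piece 2 can be reached by continuity from the free point. [folklore] -/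
theorem not_simpleAt_zero : ∀ δ ∈ Set.Ioo (0:ℝ) (1 / 2), ¬ SimpleAt 0 δ :=
  jmCusp_clauseII_fails_at_zero_coupling

/-- Calibration on the attractive side (outside the quadrant): `SimpleAt U δ` for every `U < 0` (Lieb 1989,
Theorem 1; p142929). [folklore] -/
theorem simpleAt_of_neg : ∀ U : ℝ, U < 0 → ∀ δ ∈ Set.Ioo (0:ℝ) (1 / 2), SimpleAt U δ :=
  jmCusp_clauseII_holds_at_attractive_coupling

/-! ### STRENGTHEN: more rigid forms and what the rigidity buys -/

/-- S⁺₁: the summit's matrix at an eventually simple point. [folklore] -/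
def SummitAtSimplePoint : Prop :=
  ∃ U : ℝ, 0 < U ∧ ∃ δ ∈ Set.Ioo (0:ℝ) (1 / 2), HasDWavePairFieldLROAt U δ ∧ SimpleAt U δ

/-- S⁺₁ ⇒ crux (p140841): the strengthening is literally the summit at a point plus clause (ii).
[folklore] -/
theorem jmCusp_of_summitAtSimplePoint (h : SummitAtSimplePoint) : JmCusp :=
  jmCusp_of_hasDWavePairFieldLROAt_and_simple h

/-- Finite-volume `d`-wave pair order of ONE ground-state sequence of `(N_L, 0)` at `(U, δ)` (the hypothesis
shape of `jmCusp_of_floorOrder_and_simple`). [folklore] -/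
def FloorOrderAt (U δ : ℝ) : Prop :=
  ∃ c : ℝ, 0 < c ∧ ∃ L₀ : ℕ, ∀ (L : ℕ) [NeZero L], Even L → L₀ ≤ L →
    ∃ g : Fock (Orb (FermionTorus 2 L)),
      IsGroundStateInSector (hubbardTorus 2 L 1 U) (2 * ⌊(1 - δ) * (L : ℝ) ^ 2 / 2⌋₊) 0 g ∧
      star g ⬝ᵥ g = 1 ∧
      c * (L : ℝ) ^ 4 ≤
        (star (pairField dWaveFormFactor L *ᵥ g) ⬝ᵥ (pairField dWaveFormFactor L *ᵥ g)).re

/-- A uniform in-sector spectral gap `γ/L` above the `(N_L, 0)` floor (the finite-size nodal gap one expects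
at a clean `d`-wave point): every unit vector of the sector orthogonal to all ground states has energy at
least `e(N_L) + γ/L`. [folklore] -/
def InSectorGapAt (U δ : ℝ) : Prop :=
  ∃ γ : ℝ, 0 < γ ∧ ∃ L₀ : ℕ, ∀ (L : ℕ) [NeZero L], Even L → L₀ ≤ L →
    ∀ v : Fock (Orb (FermionTorus 2 L)),
      v ∈ szSector (2 * ⌊(1 - δ) * (L : ℝ) ^ 2 / 2⌋₊) 0 → star v ⬝ᵥ v = 1 →
      (∀ φ : Fock (Orb (FermionTorus 2 L)),
          IsGroundStateInSector (hubbardTorus 2 L 1 U) (2 * ⌊(1 - δ) * (L : ℝ) ^ 2 / 2⌋₊) 0 φ →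
            star φ ⬝ᵥ v = 0) →
      (hubbardTorus 2 L 1 U).minEnergyOn (szSector (2 * ⌊(1 - δ) * (L : ℝ) ^ 2 / 2⌋₊) 0) + γ / (L : ℝ) ≤
        (star v ⬝ᵥ (hubbardTorus 2 L 1 U *ᵥ v)).re

/-- S⁺₂: a gapped, simple, ordered point (the most rigid finite-volume picture of a clean `d`-wave point).
[folklore] -/
def GappedRigidPoint : Prop :=
  ∃ U : ℝ, 0 < U ∧ ∃ δ ∈ Set.Ioo (0:ℝ) (1 / 2), FloorOrderAt U δ ∧ InSectorGapAt U δ ∧ SimpleAt U δ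

/-- S⁺₂ ⇒ crux, and the proof DISCARDS the gap: the added rigidity is not consumed by any arrow towards the
crux (`jmCusp_of_floorOrder_and_simple`, p134917).  The gap would only matter to an engine producing
`FloorOrderAt`, and no such engine takes a `γ/L` gap as input (stability theorems need gaps uniform in `L`).
[folklore] -/
theorem jmCusp_of_gappedRigidPoint (h : GappedRigidPoint) : JmCusp := by
  obtain ⟨U, hU, δ, hδ, hF, _hgap, hS⟩ := h
  exact jmCusp_of_floorOrder_and_simple ⟨U, hU, δ, hδ, hF, hS⟩

/-- S⁺₃ (strengthening clause (i) alone): UNIFORM zero-excess order — EVERY unit vector of `(N_L, 0)` within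
`εL²` of the floor has `‖Δ_d v‖² ≥ cL⁴` (an operator-inequality / infrared-bound shaped statement; it would
make every ground state ordered, hence serve the summit's "every sequence" directly). [folklore] -/
def UniformZepoAt (U δ : ℝ) : Prop :=
  ∃ c : ℝ, 0 < c ∧ ∃ ε : ℝ, 0 < ε ∧ ∃ L₀ : ℕ, ∀ (L : ℕ) [NeZero L], Even L → L₀ ≤ L →
    ∀ v : Fock (Orb (FermionTorus 2 L)),
      v ∈ szSector (2 * ⌊(1 - δ) * (L : ℝ) ^ 2 / 2⌋₊) 0 → star v ⬝ᵥ v = 1 →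
      (star v ⬝ᵥ (hubbardTorus 2 L 1 U *ᵥ v)).re ≤
          (hubbardTorus 2 L 1 U).minEnergyOn (szSector (2 * ⌊(1 - δ) * (L : ℝ) ^ 2 / 2⌋₊) 0) + ε * (L : ℝ) ^ 2 →
      c * (L : ℝ) ^ 4 ≤
        (star (pairField dWaveFormFactor L *ᵥ v) ⬝ᵥ (pairField dWaveFormFactor L *ᵥ v)).re

/-- Uniform zero-excess order gives floor order of a ground-state sequence (a ground state has zero excess;
a unit ground state exists in the sector, `exists_unit_isGroundStateInSector_hubbardTorus`). [folklore] -/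
theorem floorOrderAt_of_uniformZepoAt (U δ : ℝ) (hδ : δ ∈ Set.Ioo (0:ℝ) (1 / 2))
    (h : UniformZepoAt U δ) : FloorOrderAt U δ := by
  obtain ⟨c, hc, ε, hε, L₀, hL⟩ := h
  refine ⟨c, hc, L₀, fun L _ hE hLL => ?_⟩
  obtain ⟨g, hg1, hgs⟩ := exists_unit_isGroundStateInSector_hubbardTorus U L ⌊(1 - δ) * (L : ℝ) ^ 2 / 2⌋₊
    (natFloor_filling_le_sq (δ := δ) (by linarith [hδ.1]) L)
  refine ⟨g, hgs, hg1, hL L hE hLL g hgs.1 hg1 ?_⟩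
  have hre : (star g ⬝ᵥ (hubbardTorus 2 L 1 U *ᵥ g)).re =
      (hubbardTorus 2 L 1 U).minEnergyOn (szSector (2 * ⌊(1 - δ) * (L : ℝ) ^ 2 / 2⌋₊) 0) := by
    rw [hgs.2.2, dotProduct_smul, hg1, smul_eq_mul, mul_one, Complex.ofReal_re]
  rw [hre]
  have : 0 ≤ ε * (L : ℝ) ^ 2 := by positivity
  linarith

/-- Even the uniform strengthening of clause (i) reaches the CRUX only together with clause (ii) verbatim:
strengthening (i) cannot discharge (ii), because (ii) is a conjunct of the fixed crux. [folklore] -/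
theorem jmCusp_of_uniformZepo_and_simple
    (h : ∃ U : ℝ, 0 < U ∧ ∃ δ ∈ Set.Ioo (0:ℝ) (1 / 2), UniformZepoAt U δ ∧ SimpleAt U δ) : JmCusp := by
  obtain ⟨U, hU, δ, hδ, hZ, hS⟩ := h
  exact jmCusp_of_floorOrder_and_simple ⟨U, hU, δ, hδ, floorOrderAt_of_uniformZepoAt U δ hδ hZ, hS⟩

/-! ### NEGATION: the shape of a counterexample -/

/-- `¬JmCusp` in normal form: at EVERY point of the quadrant, zero-excess pair order excludes eventual
simplicity — a statement about the whole phase diagram of the pure model.  A counterexample to the crux is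
therefore never a computation at one `(U, δ, L)`. [folklore] -/
theorem not_jmCusp_iff :
    ¬ JmCusp ↔ ∀ U : ℝ, 0 < U → ∀ δ ∈ Set.Ioo (0:ℝ) (1 / 2), ZepoAt U δ → ¬ SimpleAt U δ := by
  rw [jmCusp_iff_exists_zepoAt_and_simpleAt]
  constructor
  · intro h U hU δ hδ hZ hS
    exact h ⟨U, hU, δ, hδ, hZ, hS⟩
  · rintro h ⟨U, hU, δ, hδ, hZ, hS⟩
    exact h U hU δ hδ hZ hS

/-- The two one-clause routes to a counterexample, typed: either NO point of the quadrant has the core, or NO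
point has eventually simple floors; each alone refutes the crux. [folklore] -/
theorem not_jmCusp_of_noCore (h : ∀ U : ℝ, 0 < U → ∀ δ ∈ Set.Ioo (0:ℝ) (1 / 2), ¬ ZepoAt U δ) :
    ¬ JmCusp :=
  not_jmCusp_iff.2 fun U hU δ hδ hZ _ => h U hU δ hδ hZ

theorem not_jmCusp_of_noSimple (h : ∀ U : ℝ, 0 < U → ∀ δ ∈ Set.Ioo (0:ℝ) (1 / 2), ¬ SimpleAt U δ) :
    ¬ JmCusp :=
  not_jmCusp_iff.2 fun U hU δ hδ _ hS => h U hU δ hδ hS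

/-- … and the first of them would refute the SUMMIT itself (the core is below the summit point by point), so
it is not a crux-level negation at all. [folklore] -/
theorem not_summit_of_noCore (h : ∀ U : ℝ, 0 < U → ∀ δ ∈ Set.Ioo (0:ℝ) (1 / 2), ¬ ZepoAt U δ) :
    ¬ _root_.HubbardSuperconductivity :=
  fun hS => by
    obtain ⟨U, hU, δ, hδ, hZ⟩ := coreAtSomePoint_of_summit hS
    exact h U hU δ hδ hZ

/-! ### TRANSFER: the solved siblings present in the tree, by name -/

/-- Sibling of clause (i): Kennedy–Lieb–Shastry 1988 — ground-state LRO of the quantum XY model on even tori,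
`d ≥ 2`, every spin, by spatial reflection positivity + Gaussian domination + the energetic sum rule (PROVED
in the tree).  The census records where each of its three inputs breaks for the doped repulsive Hubbard
`d`-wave pair field. [cite: KennedyLiebShastry1988, Theorem] -/
theorem transfer_anchor_KLS : kennedy_lieb_shastry_xy_ground :=
  kennedy_lieb_shastry_xy_ground_holds

/-- Sibling of clause (ii): Lieb 1989 Theorem 2 — at half filling (`δ = 0`, outside the open quadrant) the
`(L², 0)` floor of the repulsive torus is simple for every `U > 0` (p143372). [cite: LiebPRL1989, Theorem 2] -/
theorem transfer_anchor_LiebTwo :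
    ∀ U : ℝ, 0 < U → ∃ L₀ : ℕ, ∀ (L : ℕ), Even L → L₀ ≤ L →
      ∀ φ φ' : Fock (Orb (FermionTorus 2 L)),
        IsGroundStateInSector (hubbardTorus 2 L 1 U) (2 * ⌊(1 - 0) * (L : ℝ) ^ 2 / 2⌋₊) 0 φ →
        IsGroundStateInSector (hubbardTorus 2 L 1 U) (2 * ⌊(1 - 0) * (L : ℝ) ^ 2 / 2⌋₊) 0 φ' →
        ∃ c : ℂ, φ' = c • φ :=
  jmCusp_clauseII_holds_at_half_filling

end Summit.HubbardSuperconductivity.HubbardSuperconductivity.Cruxes.JmCusp.StrategyCensus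

end
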